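import Summits.Parity.GeneralizedHardyLittlewood.Theses.VarianceWitness
import HarnessLib

/-!
# Route `VarianceWitness`: the redirect assembly of the target node (support item stmt-Parity-18115), closed

The route's target node `UniformRelativeDimOne` (S⁺ = t-uniform relative Dickson–Hardy–Littlewood,
stmt-Parity-18098) is at least the sub-problem Statement (landed amplification door
`Cruxes.AbsoluteUpgrade.UniformAmplification.generalizedHardyLittlewood_of_uniformRelativeDimOne`), so by the
redirect rule its OWN decomposition must be certified one level down: two load-bearing open pieces — the
local t-uniform inverse theorem `InverseDicksonUniform` (crux 2, stmt-Parity-17969) and the zero side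
`TwistedVarianceRate` (crux 3, stmt-Parity-18096) — and a PROVED assembly. This file lands the assembly
`uniformRelativeDimOne_of_cruxes : InverseDicksonUniform → TwistedVarianceRate → UniformRelativeDimOne`
(the route's support item `UniformRelativeDimOneOfCruxes`), verbatim the body of the certified deciding
theorem `Theses.VarianceWitness.closes` minus its door binder: contraposition through the LOCALIZED
witness — given `(A, L, ε)` take `(κ, δ, C, B, N₀)` from the inverse theorem and `x₀` from the zero side at
`(κ, δ/2, C)`; for `N ≥ max (max N₀ x₀) 3` an anomaly of a `t`-system would give `x ∈ [N, N^B]` (so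
`log log x > 0`), `q ≤ x^(1−κ)`, `|τ| ≤ x` with `δx²/(φ(q)(log log x)^C) ≤ V_Λ(x;q,τ) ≤ (δ/2)x²/(φ(q)(log log x)^C)`,
absurd. No analytic input; no new imports beyond the route file.

References: B. Green, T. Tao, *Linear equations in primes*, Ann. of Math. 171 (2010), Conj. 1.4 (the
relative error shape) [GreenTao2010].
-/

namespace Summit.Parity.GeneralizedHardyLittlewood.Theorems

open Summit.Parity.GeneralizedHardyLittlewood.Theses.VarianceWitness

/-- **Redirect assembly of route `VarianceWitness`** (support item stmt-Parity-18115,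
`UniformRelativeDimOneOfCruxes := InverseDicksonUniform → TwistedVarianceRate → UniformRelativeDimOne`):
the two open cruxes give the target node S⁺ by contraposition through the localized variance witness.
[cite: GreenTao2010, Conj. 1.4] -/
theorem uniformRelativeDimOne_of_cruxes :
    Summit.Parity.GeneralizedHardyLittlewood.Theses.VarianceWitness.UniformRelativeDimOneOfCruxes := by
  intro hI hV A L ε hε
  obtain ⟨κ, hκ, δ, hδ, C, B, N₀, hN₀⟩ := hI A L ε hε
  obtain ⟨x₀, hx₀⟩ := hV κ hκ (δ / 2) (by positivity) C
  refine ⟨max (max N₀ x₀) 3, fun N hN t ht htA Ψ hΨ hL K hK hKN => ?_⟩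
  have hN₀N : N₀ ≤ N := le_trans (le_trans (le_max_left _ _) (le_max_left _ _)) hN
  have hx₀N : x₀ ≤ N := le_trans (le_trans (le_max_right _ _) (le_max_left _ _)) hN
  have h3N : 3 ≤ N := le_trans (le_max_right _ _) hN
  by_contra hcon
  rw [not_le] at hcon
  obtain ⟨x, hNx, -, q, hq1, hqx, τ, hτ, hwit⟩ := hN₀ N hN₀N t ht htA Ψ hΨ hL K hK hKN hcon
  have hbound := hx₀ x (le_trans hx₀N hNx) q hq1 hqx τ hτ
  have hx3 : (3 : ℝ) ≤ (x : ℝ) := by exact_mod_cast le_trans h3N hNx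
  have hxpos : (0 : ℝ) < (x : ℝ) := by linarith
  have hlog : (1 : ℝ) < Real.log (x : ℝ) := by
    rw [Real.lt_log_iff_exp_lt hxpos]
    exact lt_of_lt_of_le Real.exp_one_lt_three hx3
  have hll : (0 : ℝ) < Real.log (Real.log (x : ℝ)) := Real.log_pos hlog
  have hφpos : (0 : ℝ) < (Nat.totient q : ℝ) := by
    exact_mod_cast Nat.totient_pos.mpr (by omega)
  have hD' : (0 : ℝ) < (Nat.totient q : ℝ) * Real.log (Real.log (x : ℝ)) ^ C :=
    mul_pos hφpos (pow_pos hll C)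
  have hlt : δ / 2 * (x : ℝ) ^ 2 / ((Nat.totient q : ℝ) * Real.log (Real.log (x : ℝ)) ^ C) <
      δ * (x : ℝ) ^ 2 / ((Nat.totient q : ℝ) * Real.log (Real.log (x : ℝ)) ^ C) := by
    have hx2 : (0 : ℝ) < (x : ℝ) ^ 2 := by positivity
    rw [div_lt_div_iff_of_pos_right hD']
    nlinarith
  linarith

end Summit.Parity.GeneralizedHardyLittlewood.Theorems
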